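import Literature.MathematicalPhysics.QuantumLattice.TwistedBoundaryConditions
import HarnessLib

/-!
# 't Hooft twists as antisymmetric tensors: transposition of axes, removal of the twists through a
# lattice direction, and the stack decomposition of the twist insertion — definitions

Topic `Literature/MathematicalPhysics/QuantumFieldTheory`; vocabulary of
`QuantumLattice/TwistedBoundaryConditions.lean` (`Plane d`, `Twist d G = Plane d → Z(G)`,
`plaquetteTwist z p` — the centre element `z_{μν}` on the corner plaquette `x_μ = x_ν = -1` of each
`(μ, ν)`-plane — `IsCornerPlaquette`).  DEFINITIONS with elementary (pointwise) API, no integrals: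

* `extend z k l` — the twist as an ANTISYMMETRIC function of ORDERED pairs of directions:
  `z_{kl}` for `k < l`, `z_{lk}⁻¹` for `l < k`, `1` on the diagonal ('t Hooft, Nucl. Phys. B153 (1979) 141,
  §2 after (2.5): "`n_{μν}` … antisymmetric"; de Forcrand–von Smekal: `n_{νμ} = -n_{μν}`);
* `transposeTwist μ ν z` — the twist read in the coordinates with the axes `μ ↔ ν` exchanged,
  `(τz)_{kl} = ẑ_{τk, τl}` (the relabelling under which `TwistedPartitionFunction.configTranspose`
  transports the twisted action; one plane: `TwistedPartitionFunction.orderedInsertion`);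
* `spatialPart z` (all twists through the time direction `0` removed: 't Hooft's magnetic part `m` of
  `(k, m)`, (2.5) `n_{ij} = m_k`), `eraseDir μ z` (all twists through the direction `μ` removed),
  `eraseBelow m z` (all twists through a direction `< m` removed; `eraseBelow (d-1) z = 1`);
* `temporalStacks w a b` — the centre-valued insertion `w_ν` on the stack `{x_0 = a, x_ν = b_ν}` of every
  temporal plane `(0, ν)` ('t Hooft's temporal twists `n_{0i} = k_i` as plaquette insertions; one plane:
  `TwistedPartitionFunction.stackInsertion`), and ★ the STACK DECOMPOSITION of the twist insertion
  `z_p⁻¹ = (spatialPart z)_p⁻¹ · temporalStacks (ν ↦ ẑ_{0ν}⁻¹) (-1) (-1) p` (`plaquetteTwist_inv_eq_mul`):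
  the corner plaquettes of the temporal planes form the temporal stacks at time `-1`.

* (Revision 1) `invertDir μ z` — the twist read in the coordinates with the axis `μ` REVERSED
  (`x_μ ↦ -x_μ`): `z_{kl}⁻¹` on the planes containing `μ` (their orientation is reversed), `z_{kl}`
  elsewhere ('t Hooft §6: "W will be invariant under joint rotations of `a_μ` and `n_{μν}`" — the axis
  reflections and transpositions generate the lattice symmetry group of the symmetric torus); for `μ = 0`
  this is 't Hooft's `(k, m) ↦ (-k, m)`.

These are the combinatorial objects of the reflection-positivity monotonicity theorems for multi-plane
twists (files `TwistedPartitionFunctionTemporalBound`, `TwistedPartitionFunctionMonotone`).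
HONEST FRAMING: bookkeeping definitions; nothing is asserted about partition functions here.

## References
* G. 't Hooft, Nucl. Phys. B153 (1979) 141–160, §2 eqs. (2.2)–(2.6), §6 first sentence and (6.1)–(6.2). [tHooft1979Flux]
* Ph. de Forcrand, L. von Smekal, Phys. Rev. D66 (2002) 011504, §"Twisted boundary conditions and
  electric fluxes". [ForcrandSmekal2002]
-/

namespace Literature.MathematicalPhysics.QuantumFieldTheory

noncomputable section

namespace MultiTwist

open QuantumLattice

/-! ## The antisymmetric extension and the transposition of axes -/

section Extend

variable {d : ℕ} {G : Type*} [Group G]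

/-- **The twist as an antisymmetric tensor on ordered pairs of directions**: `ẑ_{kl} = z_{kl}` for
`k < l`, `ẑ_{kl} = z_{lk}⁻¹` for `l < k`, `ẑ_{kk} = 1` ('t Hooft's `n_{μν}` is antisymmetric; only the
entries `μ < ν` are data in `Twist d G`). [cite: tHooft1979Flux, §2 eq. (2.5)] -/
def extend (z : Twist d G) (k l : Fin d) : Subgroup.center G :=
  if h : k < l then z ⟨(k, l), h⟩ else if h' : l < k then (z ⟨(l, k), h'⟩)⁻¹ else 1

/-- Above the diagonal the extension is the twist. [cite: tHooft1979Flux, §2 eq. (2.5)] -/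
theorem extend_of_lt (z : Twist d G) {k l : Fin d} (h : k < l) : extend z k l = z ⟨(k, l), h⟩ := by
  unfold extend
  rw [dif_pos h]

/-- Below the diagonal the extension is the inverse twist. [cite: tHooft1979Flux, §2 eq. (2.5)] -/
theorem extend_of_gt (z : Twist d G) {k l : Fin d} (h : l < k) : extend z k l = (z ⟨(l, k), h⟩)⁻¹ := by
  unfold extend
  rw [dif_neg (lt_asymm h), dif_pos h]

/-- On the diagonal the extension is `1`. [cite: tHooft1979Flux, §2 eq. (2.5)] -/
@[simp] theorem extend_self (z : Twist d G) (k : Fin d) : extend z k k = 1 := by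
  unfold extend
  rw [dif_neg (lt_irrefl k), dif_neg (lt_irrefl k)]

/-- On a plane (a pair `μ < ν`) the extension is the twist. [cite: tHooft1979Flux, §2 eq. (2.5)] -/
@[simp] theorem extend_plane (z : Twist d G) (q : Plane d) : extend z q.1.1 q.1.2 = z q := by
  rw [extend_of_lt z q.2]

/-- **Antisymmetry** `ẑ_{lk} = ẑ_{kl}⁻¹`. [cite: tHooft1979Flux, §2 eq. (2.5)] -/
theorem extend_swap (z : Twist d G) (k l : Fin d) : extend z l k = (extend z k l)⁻¹ := by
  rcases lt_trichotomy k l with h | rfl | h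
  · rw [extend_of_lt z h, extend_of_gt z h]
  · simp
  · rw [extend_of_gt z h, extend_of_lt z h, inv_inv]

/-- The trivial twist extends to `1`. [cite: tHooft1979Flux, §2 eq. (2.5)] -/
@[simp] theorem extend_one (k l : Fin d) : extend (1 : Twist d G) k l = 1 := by
  unfold extend
  split_ifs <;> simp

/-- Two twists with the same antisymmetric extension are equal. [cite: tHooft1979Flux, §2 eq. (2.5)] -/
theorem ext_of_extend {z z' : Twist d G} (h : ∀ k l, k < l → extend z k l = extend z' k l) : z = z' := by
  funext q
  rw [← extend_plane z q, ← extend_plane z' q, h _ _ q.2]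

/-- **The transposed twist**: the twist in the coordinates with the axes `μ` and `ν` exchanged,
`(τz)_{kl} = ẑ_{τk, τl}` for `k < l` (if `τ` reverses the order of the pair, the inverse twist appears:
the twisted plaquettes are met in the reversed orientation). [cite: ForcrandSmekal2002, §"Twisted boundary conditions and electric fluxes"] -/
def transposeTwist (μ ν : Fin d) (z : Twist d G) : Twist d G :=
  fun q => extend z (Equiv.swap μ ν q.1.1) (Equiv.swap μ ν q.1.2)

/-- The extension of the transposed twist is the transposed extension (all ordered pairs).
[cite: ForcrandSmekal2002, §"Twisted boundary conditions and electric fluxes"] -/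
theorem extend_transposeTwist (μ ν : Fin d) (z : Twist d G) (k l : Fin d) :
    extend (transposeTwist μ ν z) k l = extend z (Equiv.swap μ ν k) (Equiv.swap μ ν l) := by
  rcases lt_trichotomy k l with h | rfl | h
  · rw [extend_of_lt _ h]
    rfl
  · rw [extend_self, extend_self]
  · rw [extend_of_gt _ h]
    change (extend z (Equiv.swap μ ν l) (Equiv.swap μ ν k))⁻¹ = _
    rw [extend_swap z (Equiv.swap μ ν k) (Equiv.swap μ ν l), inv_inv]

/-- Transposing twice gives back the twist. [cite: tHooft1979Flux, §2 eq. (2.5)] -/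
@[simp] theorem transposeTwist_transposeTwist (μ ν : Fin d) (z : Twist d G) :
    transposeTwist μ ν (transposeTwist μ ν z) = z :=
  ext_of_extend fun k l _ => by
    rw [extend_transposeTwist, extend_transposeTwist, Equiv.swap_apply_self, Equiv.swap_apply_self]

/-- The trivial twist is transposition invariant. [cite: tHooft1979Flux, §2 eq. (2.5)] -/
@[simp] theorem transposeTwist_one (μ ν : Fin d) : transposeTwist μ ν (1 : Twist d G) = 1 := by
  funext q
  simp [transposeTwist]

/-- Transposing an axis with itself does nothing. [cite: tHooft1979Flux, §2 eq. (2.5)] -/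
@[simp] theorem transposeTwist_self (μ : Fin d) (z : Twist d G) : transposeTwist μ μ z = z :=
  ext_of_extend fun k l _ => by rw [extend_transposeTwist, Equiv.swap_self, Equiv.refl_apply,
    Equiv.refl_apply]

end Extend

/-! ## Removing the twists through a direction -/

section Erase

variable {d : ℕ} {G : Type*} [Group G]

/-- **All twists through the direction `μ` removed**: `(eraseDir μ z)_{kl} = 1` if `μ ∈ {k, l}`, else
`z_{kl}`. [cite: tHooft1979Flux, §2 eq. (2.5)] -/
def eraseDir (μ : Fin d) (z : Twist d G) : Twist d G :=
  fun q => if q.1.1 = μ ∨ q.1.2 = μ then 1 else z q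

/-- Pointwise formula. [cite: tHooft1979Flux, §2 eq. (2.5)] -/
theorem eraseDir_apply (μ : Fin d) (z : Twist d G) (q : Plane d) :
    eraseDir μ z q = if q.1.1 = μ ∨ q.1.2 = μ then 1 else z q := rfl

/-- The extension of the erased twist. [cite: tHooft1979Flux, §2 eq. (2.5)] -/
theorem extend_eraseDir (μ : Fin d) (z : Twist d G) (k l : Fin d) :
    extend (eraseDir μ z) k l = if k = μ ∨ l = μ then 1 else extend z k l := by
  rcases lt_trichotomy k l with h | rfl | h
  · rw [extend_of_lt _ h, extend_of_lt _ h]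
    rfl
  · simp
  · rw [extend_of_gt _ h, extend_of_gt _ h, eraseDir_apply]
    simp only
    by_cases hc : l = μ ∨ k = μ
    · rw [if_pos hc, if_pos (Or.comm.1 hc), inv_one]
    · rw [if_neg hc, if_neg (fun h' => hc (Or.comm.1 h'))]

/-- Erasing the trivial twist. [cite: tHooft1979Flux, §2 eq. (2.5)] -/
@[simp] theorem eraseDir_one (μ : Fin d) : eraseDir μ (1 : Twist d G) = 1 := by
  funext q
  simp [eraseDir]

/-- Erasing twice the same direction. [cite: tHooft1979Flux, §2 eq. (2.5)] -/
@[simp] theorem eraseDir_eraseDir (μ : Fin d) (z : Twist d G) : eraseDir μ (eraseDir μ z) = eraseDir μ z := by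
  funext q
  simp only [eraseDir]
  split_ifs <;> rfl

/-- Erasures of different directions commute. [cite: tHooft1979Flux, §2 eq. (2.5)] -/
theorem eraseDir_comm (μ μ' : Fin d) (z : Twist d G) :
    eraseDir μ (eraseDir μ' z) = eraseDir μ' (eraseDir μ z) := by
  funext q
  simp only [eraseDir]
  split_ifs <;> rfl

/-- **Transporting the erasure**: erasing the direction `μ` is — in the transposed coordinates
`0 ↔ μ` — erasing the time direction `0` (and transposing back). [cite: tHooft1979Flux, §2 eq. (2.5)] -/
theorem transposeTwist_eraseDir_zero_transposeTwist [NeZero d] (μ : Fin d) (z : Twist d G) :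
    transposeTwist 0 μ (eraseDir 0 (transposeTwist 0 μ z)) = eraseDir μ z :=
  ext_of_extend fun k l _ => by
    rw [extend_transposeTwist, extend_eraseDir, extend_eraseDir, extend_transposeTwist,
      Equiv.swap_apply_self, Equiv.swap_apply_self]
    have hk : Equiv.swap (0 : Fin d) μ k = 0 ↔ k = μ := by
      rw [Equiv.swap_apply_eq_iff, Equiv.swap_apply_left]
    have hl : Equiv.swap (0 : Fin d) μ l = 0 ↔ l = μ := by
      rw [Equiv.swap_apply_eq_iff, Equiv.swap_apply_left]
    simp only [hk, hl]

/-- **All twists through a direction `< m` removed** (the `m`-th stage of removing the twists direction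
by direction). [cite: tHooft1979Flux, §2 eq. (2.5)] -/
def eraseBelow (m : ℕ) (z : Twist d G) : Twist d G :=
  fun q => if (q.1.1 : ℕ) < m then 1 else z q

/-- Stage `0`: nothing removed. [cite: tHooft1979Flux, §2 eq. (2.5)] -/
@[simp] theorem eraseBelow_zero (z : Twist d G) : eraseBelow 0 z = z := by
  funext q
  simp [eraseBelow]

/-- Stage `m + 1` = stage `m` followed by erasing the direction `m`. [cite: tHooft1979Flux, §2 eq. (2.5)] -/
theorem eraseBelow_succ {m : ℕ} (hm : m < d) (z : Twist d G) :
    eraseBelow (m + 1) z = eraseDir ⟨m, hm⟩ (eraseBelow m z) := by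
  funext q
  simp only [eraseBelow, eraseDir, Fin.ext_iff]
  have h12 : (q.1.1 : ℕ) < q.1.2 := q.2
  by_cases h1 : (q.1.1 : ℕ) = m
  · rw [if_pos (by omega), if_pos (Or.inl h1)]
  · by_cases h2 : (q.1.2 : ℕ) = m
    · rw [if_pos (by omega), if_pos (Or.inr h2)]
    · rw [if_neg (by omega : ¬ ((q.1.1 : ℕ) = m ∨ (q.1.2 : ℕ) = m))]
      by_cases h3 : (q.1.1 : ℕ) < m
      · rw [if_pos (by omega), if_pos h3]
      · rw [if_neg (by omega), if_neg h3]

/-- After the stage `d - 1` every twist is removed: each plane `μ < ν ≤ d - 1` contains a direction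
`< d - 1`. [cite: tHooft1979Flux, §2 eq. (2.5)] -/
theorem eraseBelow_pred (z : Twist d G) : eraseBelow (d - 1) z = 1 := by
  funext q
  have h12 : (q.1.1 : ℕ) < q.1.2 := q.2
  have h2 : (q.1.2 : ℕ) < d := q.1.2.2
  simp only [eraseBelow]
  rw [if_pos (by omega)]
  rfl

variable [NeZero d]

/-- **The spatial (magnetic) part of a twist**: all twists through the time direction `0` removed
('t Hooft (2.5): the twist `(k, m)` with the temporal entries `n_{0i} = k_i` set to zero).
[cite: tHooft1979Flux, §2 eq. (2.5)] -/
def spatialPart (z : Twist d G) : Twist d G :=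
  fun q => if q.1.1 = 0 then 1 else z q

/-- Pointwise formula. [cite: tHooft1979Flux, §2 eq. (2.5)] -/
theorem spatialPart_apply (z : Twist d G) (q : Plane d) :
    spatialPart z q = if q.1.1 = 0 then 1 else z q := rfl

/-- In a plane `μ < ν` only `μ` can be the time direction `0`. [cite: tHooft1979Flux, §2 eq. (2.5)] -/
theorem plane_snd_ne_zero (q : Plane d) : q.1.2 ≠ 0 := fun h => by
  have := q.2
  rw [h] at this
  exact (Fin.not_lt_zero _) this

/-- `spatialPart = eraseDir 0`. [cite: tHooft1979Flux, §2 eq. (2.5)] -/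
theorem eraseDir_zero (z : Twist d G) : eraseDir 0 z = spatialPart z := by
  funext q
  simp only [eraseDir, spatialPart, plane_snd_ne_zero q, or_false]

/-- The spatial part of the trivial twist. [cite: tHooft1979Flux, §2 eq. (2.5)] -/
@[simp] theorem spatialPart_one : spatialPart (1 : Twist d G) = 1 := by
  rw [← eraseDir_zero, eraseDir_one]

/-- The spatial part is idempotent. [cite: tHooft1979Flux, §2 eq. (2.5)] -/
@[simp] theorem spatialPart_spatialPart (z : Twist d G) : spatialPart (spatialPart z) = spatialPart z := by
  funext q
  simp only [spatialPart]
  split_ifs <;> rfl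

/-- On a temporal plane the spatial part is trivial. [cite: tHooft1979Flux, §2 eq. (2.5)] -/
theorem spatialPart_of_eq_zero (z : Twist d G) {q : Plane d} (hq : q.1.1 = 0) : spatialPart z q = 1 :=
  if_pos hq

/-- On a spatial plane the spatial part is the twist. [cite: tHooft1979Flux, §2 eq. (2.5)] -/
theorem spatialPart_of_ne_zero (z : Twist d G) {q : Plane d} (hq : q.1.1 ≠ 0) : spatialPart z q = z q :=
  if_neg hq

end Erase

/-! ## Temporal stacks and the stack decomposition of the twist insertion -/

section Stacks

variable {d L : ℕ} [NeZero d] {G : Type*} [Group G]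

/-- **The temporal stacks at time `a`**: the insertion `w_ν` on the plaquettes of the temporal plane
`(0, ν)` based in the stack `{x_0 = a, x_ν = b_ν}`, for every spatial direction `ν` at once, `1` on all
other plaquettes ('t Hooft's temporal twists `n_{0i}`; for one plane this is
`TwistedPartitionFunction.stackInsertion w_ν (0, ν) a b_ν`). [cite: tHooft1979Flux, §2 eqs. (2.5)–(2.6)] -/
def temporalStacks (w : Fin d → G) (a : ZMod L) (b : Fin d → ZMod L) : Plaquette d L → G :=
  fun p => if p.2.1.1 = 0 ∧ p.1 0 = a ∧ p.1 p.2.1.2 = b p.2.1.2 then w p.2.1.2 else 1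

/-- Pointwise formula. [cite: tHooft1979Flux, §2 eqs. (2.5)–(2.6)] -/
theorem temporalStacks_apply (w : Fin d → G) (a : ZMod L) (b : Fin d → ZMod L) (p : Plaquette d L) :
    temporalStacks w a b p = if p.2.1.1 = 0 ∧ p.1 0 = a ∧ p.1 p.2.1.2 = b p.2.1.2 then w p.2.1.2 else 1 :=
  rfl

/-- The temporal stacks vanish on spatial plaquettes. [cite: tHooft1979Flux, §2 eq. (2.5)] -/
theorem temporalStacks_of_ne_zero (w : Fin d → G) (a : ZMod L) (b : Fin d → ZMod L)
    {p : Plaquette d L} (hp : p.2.1.1 ≠ 0) : temporalStacks w a b p = 1 := by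
  rw [temporalStacks_apply, if_neg (fun h => hp h.1)]

/-- The temporal stacks vanish off the time slice `a`. [cite: tHooft1979Flux, §2 eq. (2.5)] -/
theorem temporalStacks_of_time_ne (w : Fin d → G) {a : ZMod L} (b : Fin d → ZMod L)
    {p : Plaquette d L} (hp : p.1 0 ≠ a) : temporalStacks w a b p = 1 := by
  rw [temporalStacks_apply, if_neg (fun h => hp h.2.1)]

/-- Trivial stacks. [cite: tHooft1979Flux, §2 eq. (2.5)] -/
@[simp] theorem temporalStacks_one (a : ZMod L) (b : Fin d → ZMod L) :
    temporalStacks (fun _ => (1 : G)) a b = fun _ : Plaquette d L => (1 : G) := by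
  funext p
  simp [temporalStacks]

/-- The temporal stacks are multiplicative in the inserted elements. [cite: tHooft1979Flux, §2 eq. (2.5)] -/
theorem temporalStacks_mul (w w' : Fin d → G) (a : ZMod L) (b : Fin d → ZMod L) :
    temporalStacks (fun ν => w ν * w' ν) a b =
      fun p : Plaquette d L => temporalStacks w a b p * temporalStacks w' a b p := by
  funext p
  simp only [temporalStacks]
  split_ifs <;> simp

/-- The temporal stacks of the inverses. [cite: tHooft1979Flux, §2 eq. (2.5)] -/
theorem temporalStacks_inv (w : Fin d → G) (a : ZMod L) (b : Fin d → ZMod L) :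
    temporalStacks (fun ν => (w ν)⁻¹) a b = fun p : Plaquette d L => (temporalStacks w a b p)⁻¹ := by
  funext p
  simp only [temporalStacks]
  split_ifs <;> simp

/-- Temporal stacks of central elements take central values. [cite: tHooft1979Flux, §2 eq. (2.5)] -/
theorem temporalStacks_mem_center {w : Fin d → G} (hw : ∀ ν, w ν ∈ Subgroup.center G) (a : ZMod L)
    (b : Fin d → ZMod L) (p : Plaquette d L) : temporalStacks w a b p ∈ Subgroup.center G := by
  unfold temporalStacks
  split_ifs
  · exact hw _
  · exact Subgroup.one_mem _

omit [NeZero d] in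
/-- The twist insertion through the antisymmetric extension: `z_p = ẑ_{μν}` on the corner plaquette
`x_μ = x_ν = -1` of the plane `(μ, ν)` of `p`, `1` otherwise. [cite: tHooft1979Flux, §2 eq. (2.5)] -/
theorem plaquetteTwist_eq_extend (z : Twist d G) (p : Plaquette d L) :
    plaquetteTwist z p =
      if p.1 p.2.1.1 = -1 ∧ p.1 p.2.1.2 = -1 then ((extend z p.2.1.1 p.2.1.2 : Subgroup.center G) : G)
      else 1 := by
  rw [extend_plane]
  rfl

omit [NeZero d] in
/-- The twist insertion `p ↦ z_p⁻¹` takes central values. [cite: tHooft1979Flux, §2 eq. (2.5)] -/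
theorem plaquetteTwist_inv_mem_center (z : Twist d G) (p : Plaquette d L) :
    (plaquetteTwist z p)⁻¹ ∈ Subgroup.center G :=
  Subgroup.inv_mem _ (plaquetteTwist_mem_center z p)

/-- The insertion of the spatial part vanishes on temporal plaquettes. [cite: tHooft1979Flux, §2 eq. (2.5)] -/
theorem plaquetteTwist_spatialPart_of_eq_zero (z : Twist d G) {p : Plaquette d L} (hp : p.2.1.1 = 0) :
    plaquetteTwist (spatialPart z) p = 1 := by
  unfold plaquetteTwist
  split_ifs
  · rw [spatialPart_of_eq_zero z hp, OneMemClass.coe_one]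
  · rfl

/-- The insertion of the spatial part agrees with the twist insertion on spatial plaquettes.
[cite: tHooft1979Flux, §2 eq. (2.5)] -/
theorem plaquetteTwist_spatialPart_of_ne_zero (z : Twist d G) {p : Plaquette d L} (hp : p.2.1.1 ≠ 0) :
    plaquetteTwist (spatialPart z) p = plaquetteTwist z p := by
  unfold plaquetteTwist
  split_ifs
  · rw [spatialPart_of_ne_zero z hp]
  · rfl

/-- The temporal corner values of a twist: `ν ↦ ẑ_{0ν}⁻¹` (the inverse, as in the tree's insertion
`z_p⁻¹`). [cite: tHooft1979Flux, §2 eq. (2.5)] -/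
def temporalCornerValues (z : Twist d G) : Fin d → G := fun ν => ((extend z 0 ν : Subgroup.center G) : G)⁻¹

/-- The temporal corner values are central. [cite: tHooft1979Flux, §2 eq. (2.5)] -/
theorem temporalCornerValues_mem_center (z : Twist d G) (ν : Fin d) :
    temporalCornerValues z ν ∈ Subgroup.center G :=
  Subgroup.inv_mem _ (extend z 0 ν).2

/-- On a temporal plane `q = (0, ν)`: `ẑ_{0ν} = z_q`. [cite: tHooft1979Flux, §2 eq. (2.5)] -/
theorem extend_zero_of_eq_zero (z : Twist d G) (q : Plane d) (hq : q.1.1 = 0) : extend z 0 q.1.2 = z q := by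
  obtain ⟨⟨i, j⟩, hij⟩ := q
  simp only at hq
  subst hq
  exact extend_of_lt z hij

/-- **The stack decomposition of the twist insertion**: the insertion `p ↦ z_p⁻¹` of the twisted Wilson
action is the insertion of the spatial part times the temporal stacks at time `-1` with the values
`ẑ_{0ν}⁻¹` at `x_ν = -1` (the corner plaquettes of the temporal planes).
[cite: tHooft1979Flux, §2 eqs. (2.5)–(2.6)] -/
theorem plaquetteTwist_inv_eq_mul (z : Twist d G) (p : Plaquette d L) :
    (plaquetteTwist z p)⁻¹ = (plaquetteTwist (spatialPart z) p)⁻¹ *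
      temporalStacks (temporalCornerValues z) (-1) (fun _ => -1) p := by
  by_cases hp : p.2.1.1 = 0
  · rw [plaquetteTwist_spatialPart_of_eq_zero z hp, inv_one, one_mul, temporalStacks_apply]
    by_cases hc : IsCornerPlaquette p
    · have hc' : p.1 p.2.1.1 = -1 ∧ p.1 p.2.1.2 = -1 := hc
      rw [hp] at hc'
      unfold plaquetteTwist
      rw [if_pos hc, if_pos ⟨hp, hc'⟩, temporalCornerValues, extend_zero_of_eq_zero z p.2 hp]
    · have hc' : ¬ (p.2.1.1 = 0 ∧ p.1 0 = -1 ∧ p.1 p.2.1.2 = -1) := fun h => hc (by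
        change p.1 p.2.1.1 = -1 ∧ p.1 p.2.1.2 = -1
        rw [hp]
        exact h.2)
      unfold plaquetteTwist
      rw [if_neg hc, if_neg hc', inv_one]
  · rw [plaquetteTwist_spatialPart_of_ne_zero z hp, temporalStacks_of_ne_zero _ _ _ hp, mul_one]

end Stacks

/-! ## Revision 1 (lit-2 g26): reversing a lattice axis — the twist with the planes through `μ` inverted -/

section Invert

variable {d : ℕ} {G : Type*} [Group G]

/-- **The twist in the coordinates with the axis `μ` reversed** (`x_μ ↦ -x_μ` reverses the orientation of
every plane containing `μ`): `(invertDir μ z)_{kl} = z_{kl}⁻¹` if `μ ∈ {k, l}`, else `z_{kl}`; for `μ = 0`,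
't Hooft's `(k, m) ↦ (-k, m)`. [cite: tHooft1979Flux, §6 first sentence and eq. (6.1)] -/
def invertDir (μ : Fin d) (z : Twist d G) : Twist d G :=
  fun q => if q.1.1 = μ ∨ q.1.2 = μ then (z q)⁻¹ else z q

/-- Pointwise formula. [cite: tHooft1979Flux, §6 eq. (6.1)] -/
theorem invertDir_apply (μ : Fin d) (z : Twist d G) (q : Plane d) :
    invertDir μ z q = if q.1.1 = μ ∨ q.1.2 = μ then (z q)⁻¹ else z q := rfl

/-- On a plane through `μ`. [cite: tHooft1979Flux, §6 eq. (6.1)] -/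
theorem invertDir_of_mem (μ : Fin d) (z : Twist d G) {q : Plane d} (hq : q.1.1 = μ ∨ q.1.2 = μ) :
    invertDir μ z q = (z q)⁻¹ := if_pos hq

/-- On a plane avoiding `μ`. [cite: tHooft1979Flux, §6 eq. (6.1)] -/
theorem invertDir_of_not_mem (μ : Fin d) (z : Twist d G) {q : Plane d} (hq : ¬ (q.1.1 = μ ∨ q.1.2 = μ)) :
    invertDir μ z q = z q := if_neg hq

/-- The extension of the axis-reversed twist: inverted on the ordered pairs containing `μ`.
[cite: tHooft1979Flux, §6 eq. (6.1)] -/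
theorem extend_invertDir (μ : Fin d) (z : Twist d G) (k l : Fin d) :
    extend (invertDir μ z) k l = if k = μ ∨ l = μ then (extend z k l)⁻¹ else extend z k l := by
  rcases lt_trichotomy k l with h | rfl | h
  · rw [extend_of_lt _ h, extend_of_lt _ h]
    rfl
  · simp
  · rw [extend_of_gt _ h, extend_of_gt _ h, invertDir_apply]
    simp only
    by_cases hc : l = μ ∨ k = μ
    · rw [if_pos hc, if_pos (Or.comm.1 hc)]
    · rw [if_neg hc, if_neg (fun h' => hc (Or.comm.1 h'))]

/-- Reversing an axis of the trivial twist. [cite: tHooft1979Flux, §6 eq. (6.1)] -/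
@[simp] theorem invertDir_one (μ : Fin d) : invertDir μ (1 : Twist d G) = 1 := by
  funext q
  simp [invertDir]

/-- Reversing the same axis twice gives back the twist. [cite: tHooft1979Flux, §6 eq. (6.1)] -/
@[simp] theorem invertDir_invertDir (μ : Fin d) (z : Twist d G) : invertDir μ (invertDir μ z) = z := by
  funext q
  simp only [invertDir]
  split_ifs <;> simp

/-- Axis reversals commute. [cite: tHooft1979Flux, §6 eq. (6.1)] -/
theorem invertDir_comm (μ μ' : Fin d) (z : Twist d G) :
    invertDir μ (invertDir μ' z) = invertDir μ' (invertDir μ z) := by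
  funext q
  simp only [invertDir]
  split_ifs <;> rfl

/-- Reversing an axis is a group homomorphism of twists. [cite: tHooft1979Flux, §6 eq. (6.1)] -/
theorem invertDir_mul (μ : Fin d) (z z' : Twist d G) :
    invertDir μ (z * z') = invertDir μ z * invertDir μ z' := by
  funext q
  simp only [invertDir, Pi.mul_apply]
  split_ifs
  · rw [mul_inv_rev]
    exact Subtype.ext (by
      rw [Subgroup.coe_mul, Subgroup.coe_mul]
      exact Subgroup.mem_center_iff.1 (z q)⁻¹.2 _)
  · rfl

/-- Reversing an axis commutes with inversion of the twist. [cite: tHooft1979Flux, §6 eq. (6.1)] -/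
theorem invertDir_inv (μ : Fin d) (z : Twist d G) : invertDir μ z⁻¹ = (invertDir μ z)⁻¹ := by
  funext q
  simp only [invertDir, Pi.inv_apply]
  split_ifs <;> rfl

/-- Erasing the direction `μ` forgets a reversal of the axis `μ`. [cite: tHooft1979Flux, §6 eq. (6.1)] -/
@[simp] theorem eraseDir_invertDir (μ : Fin d) (z : Twist d G) : eraseDir μ (invertDir μ z) = eraseDir μ z := by
  funext q
  simp only [eraseDir, invertDir]
  split_ifs <;> rfl

/-- **Transporting the reversal**: reversing the axis `μ` is — in the transposed coordinates `0 ↔ μ` —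
reversing the time axis `0` (and transposing back). [cite: tHooft1979Flux, §6 eq. (6.1)] -/
theorem transposeTwist_invertDir_zero_transposeTwist [NeZero d] (μ : Fin d) (z : Twist d G) :
    transposeTwist 0 μ (invertDir 0 (transposeTwist 0 μ z)) = invertDir μ z :=
  ext_of_extend fun k l _ => by
    rw [extend_transposeTwist, extend_invertDir, extend_invertDir, extend_transposeTwist,
      Equiv.swap_apply_self, Equiv.swap_apply_self]
    have hk : Equiv.swap (0 : Fin d) μ k = 0 ↔ k = μ := by
      rw [Equiv.swap_apply_eq_iff, Equiv.swap_apply_left]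
    have hl : Equiv.swap (0 : Fin d) μ l = 0 ↔ l = μ := by
      rw [Equiv.swap_apply_eq_iff, Equiv.swap_apply_left]
    simp only [hk, hl]

variable [NeZero d]

/-- Reversing the time axis does not change the spatial (magnetic) part. [cite: tHooft1979Flux, §6 eq. (6.1)] -/
@[simp] theorem spatialPart_invertDir_zero (z : Twist d G) : spatialPart (invertDir 0 z) = spatialPart z := by
  funext q
  simp only [spatialPart, invertDir]
  by_cases hq : q.1.1 = 0
  · rw [if_pos hq, if_pos hq]
  · rw [if_neg hq, if_neg hq, if_neg (fun h => h.elim hq (plane_snd_ne_zero q))]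

/-- Reversing the time axis of a purely spatial twist does nothing. [cite: tHooft1979Flux, §6 eq. (6.1)] -/
theorem invertDir_zero_spatialPart (z : Twist d G) : invertDir 0 (spatialPart z) = spatialPart z := by
  funext q
  simp only [spatialPart, invertDir]
  by_cases hq : q.1.1 = 0
  · rw [if_pos hq]
    split_ifs <;> simp
  · rw [if_neg hq, if_neg (fun h => h.elim hq (plane_snd_ne_zero q))]

/-- Reversing the time axis inverts the temporal corner values `ẑ_{0ν}⁻¹ ↦ ẑ_{0ν}`.
[cite: tHooft1979Flux, §6 eq. (6.1)] -/
theorem temporalCornerValues_invertDir_zero (z : Twist d G) :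
    temporalCornerValues (invertDir 0 z) = fun ν => (temporalCornerValues z ν)⁻¹ := by
  funext ν
  simp only [temporalCornerValues, extend_invertDir, true_or, if_true, Subgroup.coe_inv, inv_inv]

end Invert

end MultiTwist

end

end Literature.MathematicalPhysics.QuantumFieldTheory
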